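import Mathlib

/-!
# The obstruction tensor: Koszul exactness for binary forms in coordinates

Solo-informed programme (Langlands / W4 Eisenstein corner), session 26, §7.11 (16.13)(c) (the FORM-LEVEL
`E′` step).  A binary form of degree `n` over a commutative ring `R` is recorded by its coefficient vector
`f : Fin (n+1) → R`, `f i` = coefficient of `x^(n-i) y^i`.  Multiplication by `x` appends a zero at the end
(`Fin.snoc f 0`), multiplication by `y` prepends one (`Fin.cons 0 f`).  The two unit-derived obstruction
forms `K₁, K₂` (cubic at `p = 7`, quadratic `B₁, B₂` at `p = 5`) of the canonical Kummer class satisfy the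
single relation `x·K₁ + y·K₂ = 0` coming from the relation module `B^k = d(Sym^(k+1))`; the content of the
`E′` step is that this forces `(K₁, K₂) = (y·Q, -x·Q)` for a UNIQUE form `Q` of one degree less (the
genuine quadratic obstruction `Q′` at `p = 7`, the linear companion `M` at `p = 5`).  This is exactness of
the Koszul complex `0 → S_(n) → S_(n+1)² → S_(n+2)` of the regular sequence `(x, y)`, stated and proved in
coordinates (`x· = Fin.snoc · 0`, `y· = Fin.cons 0 ·`), in every degree and over every commutative ring,
together with the two instances used and the cubic case written out on coefficients.
-/

namespace Summit.Langlands.Langlands.Theorems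

section ObstructionTensor

variable {R : Type*} [CommRing R]

/-- `x` and `y` commute on coefficient vectors: `x·(y·f) = y·(x·f)`. -/
theorem soloInformed_snoc_cons_comm {n : ℕ} (f : Fin (n + 1) → R) :
    (Fin.snoc (Fin.cons 0 f : Fin (n + 2) → R) 0 : Fin (n + 3) → R) =
      Fin.cons 0 (Fin.snoc f 0 : Fin (n + 2) → R) :=
  (Fin.cons_snoc_eq_snoc_cons 0 f 0).symm

/-- Multiplication by `y` (`Fin.cons 0 ·`) is injective (so the form `Q` below is unique). -/
theorem soloInformed_cons_zero_injective (n : ℕ) :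
    Function.Injective (fun f : Fin (n + 1) → R => (Fin.cons 0 f : Fin (n + 2) → R)) := by
  intro f g h
  funext i
  have := congrFun h i.succ
  simpa using this

/-- Multiplication by `x` (`Fin.snoc · 0`) is injective. -/
theorem soloInformed_snoc_zero_injective (n : ℕ) :
    Function.Injective (fun f : Fin (n + 1) → R => (Fin.snoc f 0 : Fin (n + 2) → R)) := by
  intro f g h
  funext i
  have := congrFun h i.castSucc
  simpa using this

/-- The Koszul pair is a complex: `x·(y·C) + y·(-(x·C)) = 0`. -/
theorem soloInformed_koszul_complex {n : ℕ} (C : Fin (n + 1) → R) :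
    (Fin.snoc (Fin.cons 0 C : Fin (n + 2) → R) 0 : Fin (n + 3) → R) +
      Fin.cons 0 (-(Fin.snoc C 0 : Fin (n + 2) → R)) = 0 := by
  rw [soloInformed_snoc_cons_comm]
  funext i
  refine Fin.cases ?_ (fun j => ?_) i
  · simp
  · simp

/-- KOSZUL EXACTNESS IN COORDINATES (the form-level `E′` step): if two binary forms `A, B` of the same
degree satisfy `x·A + y·B = 0`, then `A = y·C` and `B = -x·C` for the form `C` = `A` with its (vanishing)
leading coefficient removed. -/
theorem soloInformed_koszul_exact {n : ℕ} (A B : Fin (n + 2) → R)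
    (h : (Fin.snoc A 0 : Fin (n + 3) → R) + Fin.cons 0 B = 0) :
    ∃ C : Fin (n + 1) → R, A = Fin.cons 0 C ∧ B = -(Fin.snoc C 0 : Fin (n + 2) → R) := by
  refine ⟨Fin.tail A, ?_, ?_⟩
  · have h0 : A 0 = 0 := by
      have := congrFun h 0
      simpa using this
    funext i
    refine Fin.cases ?_ (fun j => ?_) i
    · simpa using h0
    · simp [Fin.tail]
  · funext i
    refine Fin.lastCases ?_ (fun j => ?_) i
    · have := congrFun h (Fin.last (n + 2))
      have hl : (Fin.last (n + 2)) = (Fin.last (n + 1)).succ := (Fin.succ_last (n + 1)).symm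
      rw [hl] at this
      simp only [Pi.add_apply, Fin.cons_succ, Pi.zero_apply] at this
      rw [← hl, Fin.snoc_last, zero_add] at this
      simp [this]
    · have := congrFun h j.castSucc.succ
      simp only [Pi.add_apply, Fin.cons_succ, Pi.zero_apply] at this
      rw [Fin.succ_castSucc, Fin.snoc_castSucc] at this
      simp only [Pi.neg_apply, Fin.snoc_castSucc, Fin.tail]
      linear_combination this

/-- The form `C` in Koszul exactness is unique. -/
theorem soloInformed_koszul_unique {n : ℕ} (A : Fin (n + 2) → R) (C C' : Fin (n + 1) → R)
    (hC : A = Fin.cons 0 C) (hC' : A = Fin.cons 0 C') : C = C' :=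
  soloInformed_cons_zero_injective n (hC.symm.trans hC')

/-- THE OBSTRUCTION TENSOR AT `p = 7` (`k = 3`): two binary CUBIC forms with `x·K₁ + y·K₂ = 0` are
`(y·Q, -x·Q)` for a unique binary QUADRATIC form `Q` — in coefficients `(a,b,c,d), (e,f,g,h)`:
`a = 0, e = -b, f = -c, g = -d, h = 0` and `Q = (b, c, d)`. -/
theorem soloInformed_obstructionTensor_cubic (K₁ K₂ : Fin 4 → R)
    (h : (Fin.snoc K₁ 0 : Fin 5 → R) + Fin.cons 0 K₂ = 0) :
    ∃! Q : Fin 3 → R, K₁ = Fin.cons 0 Q ∧ K₂ = -(Fin.snoc Q 0 : Fin 4 → R) := by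
  obtain ⟨Q, hQ⟩ := soloInformed_koszul_exact K₁ K₂ h
  exact ⟨Q, hQ, fun Q' hQ' => soloInformed_koszul_unique K₁ Q' Q hQ'.1 hQ.1⟩

/-- THE COMPANION AT `p = 5` (`k = 2`): two binary QUADRATIC forms with `x·B₁ + y·B₂ = 0` are
`(y·M, -x·M)` for a unique LINEAR form `M`. -/
theorem soloInformed_obstructionTensor_quadratic (B₁ B₂ : Fin 3 → R)
    (h : (Fin.snoc B₁ 0 : Fin 4 → R) + Fin.cons 0 B₂ = 0) :
    ∃! M : Fin 2 → R, B₁ = Fin.cons 0 M ∧ B₂ = -(Fin.snoc M 0 : Fin 3 → R) := by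
  obtain ⟨M, hM⟩ := soloInformed_koszul_exact B₁ B₂ h
  exact ⟨M, hM, fun M' hM' => soloInformed_koszul_unique B₁ M' M hM'.1 hM.1⟩

/-- The cubic case written out on coefficient tuples: the five coefficient identities of
`x·(a,b,c,d) + y·(e,f,g,k) = 0` are exactly `a = 0, b + e = 0, c + f = 0, d + g = 0, k = 0`. -/
theorem soloInformed_obstructionTensor_cubic_coeff (a b c d e f g k : R) :
    (Fin.snoc ![a, b, c, d] 0 : Fin 5 → R) + Fin.cons 0 ![e, f, g, k] = 0 ↔
      (a = 0 ∧ b + e = 0 ∧ c + f = 0 ∧ d + g = 0 ∧ k = 0) := by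
  constructor
  · intro h
    have h0 := congrFun h 0
    have h1 := congrFun h 1
    have h2 := congrFun h 2
    have h3 := congrFun h 3
    have h4 := congrFun h 4
    simp at h0 h1 h2 h3 h4
    exact ⟨h0, h1, h2, h3, h4⟩
  · rintro ⟨h0, h1, h2, h3, h4⟩
    funext i
    fin_cases i <;> simp [h0, h1, h2, h3, h4]

end ObstructionTensor

end Summit.Langlands.Langlands.Theorems
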